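import Literature.Geometry.Manifold.CircleProdComplex
import HarnessLib

/-!
# The diagonal circle action on `N × ℂ`: differentials and the fundamental vector field

Companion of `CircleProdComplex.lean` (the recharted product `ProdC k N` of a `𝓡 k`-manifold
with a circle action and `ℂ`, with its diagonal action `a • mk n w = mk (a • n) (a w)`).  Through
the tangent frame `tangentLift k v z = L (v, z)` of that file this file computes:

* `hasDerivAt_coe_circleExp_mul` — `d/dt (e^{it} w) = i e^{it} w`;
* `mfderiv_const_smul_prodC_tangentLift` — **the differential of `a • ·`**:
  `d(a • ·)_{mk n w} (L (v, z)) = L (d(a • ·)_n v, a z)`;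
* `mfderiv_circleOrbit_prodC` — **the fundamental vector field of the diagonal action**:
  `d/dt|₀ (exp t • mk n w) = L (X_n, i w)` with `X_n = d/dt|₀ exp t • n` the fundamental vector of
  the action on `N` (so the generator of the diagonal action is `(X, i w)`, Cannas da Silva–
  Guillemin–Pires, §2.3: the moment map of the cut is `t² - |w|²/2`-type because the `ℂ`-factor
  rotates);
Everything here is proved; no definitions, no facts.

## References

* A. Cannas da Silva, V. Guillemin, A. R. Pires, *Symplectic Origami*, IMRN 2011 =
  arXiv:0909.4065, §2.3, proof of Prop. 2.8. [CannasdasilvaGuilleminPires2010]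
* J. M. Lee, *Introduction to Smooth Manifolds*, 2nd ed. (2012), Example 21.31.
  [LeeSmoothManifolds2013]
-/

noncomputable section

open scoped Manifold ContDiff Topology
open Set Function Filter

namespace Literature.Geometry.Manifold

namespace ProdC

variable {k : ℕ} {N : Type*} [TopologicalSpace N] [ChartedSpace (EuclideanSpace ℝ (Fin k)) N]
  [IsManifold (𝓡 k) ∞ N] [MulAction Circle N]

/-! ### The differential of the action of a group element -/

omit [IsManifold (𝓡 k) ∞ N] in
/-- `p ↦ a • p` is `mk (a • fst p) (a · snd p)`. [folklore] -/
theorem const_smul_eq (a : Circle) :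
    (fun p : ProdC k N => a • p) = fun p => (mk (a • fst p) ((a : ℂ) * snd p) : ProdC k N) := by
  funext p
  rfl

/-- Multiplication by `a` on `ℂ` has differential multiplication by `a`. [folklore] -/
theorem hasMFDerivAt_const_mul_complex (a w : ℂ) :
    HasMFDerivAt 𝓘(ℝ, ℂ) 𝓘(ℝ, ℂ) (fun z : ℂ => a * z) w
      (a • ContinuousLinearMap.id ℝ ℂ : ℂ →L[ℝ] ℂ) := by
  have h : HasFDerivAt (fun z : ℂ => a * z) (a • ContinuousLinearMap.id ℝ ℂ) w :=
    (hasFDerivAt_id w).const_mul a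
  exact hasMFDerivAt_iff_hasFDerivAt.2 h

/-- **The differential of `a • ·` on `ProdC k N` in the tangent frame**:
`d(a • ·)_p (L (v, z)) = L (d(a • ·)_{fst p} v, a z)`. [folklore] -/
theorem mfderiv_const_smul_prodC_tangentLift
    (hθ : ContMDiff ((𝓡 1).prod (𝓡 k)) (𝓡 k) ∞ (fun x : Circle × N => x.1 • x.2))
    (a : Circle) (p : ProdC k N) (v : EuclideanSpace ℝ (Fin k)) (z : ℂ) :
    mfderiv (𝓡 (k + 2)) (𝓡 (k + 2)) (fun q : ProdC k N => a • q) p (tangentLift k v z) =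
      tangentLift k (mfderiv (𝓡 k) (𝓡 k) (fun x : N => a • x) (fst p) v) ((a : ℂ) * z) := by
  have hsm : ContMDiff (𝓡 k) (𝓡 k) ∞ (fun x : N => a • x) :=
    hθ.comp (contMDiff_const.prodMk contMDiff_id)
  -- the two components as maps on `ProdC k N`
  have hg : HasMFDerivAt (𝓡 (k + 2)) (𝓡 k) (fun q : ProdC k N => a • fst q) p
      ((mfderiv (𝓡 k) (𝓡 k) (fun x : N => a • x) (fst p)).comp
        ((ContinuousLinearMap.fst ℝ (EuclideanSpace ℝ (Fin k)) ℂ).comp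
          ((prodCModelIso k).symm :
            EuclideanSpace ℝ (Fin (k + 2)) →L[ℝ] EuclideanSpace ℝ (Fin k) × ℂ))) :=
    ((hsm (fst p)).mdifferentiableAt (by simp)).hasMFDerivAt.comp p (hasMFDerivAt_fst p)
  have hh : HasMFDerivAt (𝓡 (k + 2)) 𝓘(ℝ, ℂ) (fun q : ProdC k N => (a : ℂ) * snd q) p
      (((a : ℂ) • ContinuousLinearMap.id ℝ ℂ : ℂ →L[ℝ] ℂ).comp
        ((ContinuousLinearMap.snd ℝ (EuclideanSpace ℝ (Fin k)) ℂ).comp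
          ((prodCModelIso k).symm :
            EuclideanSpace ℝ (Fin (k + 2)) →L[ℝ] EuclideanSpace ℝ (Fin k) × ℂ))) :=
    (hasMFDerivAt_const_mul_complex (a : ℂ) (snd p)).comp p (hasMFDerivAt_snd p)
  have H := hasMFDerivAt_prodC_mk (N := N) hg hh
  rw [const_smul_eq a, H.mfderiv, tangentLift_eq]
  show prodCModelIso k
      ((mfderiv (𝓡 k) (𝓡 k) (fun x : N => a • x) (fst p))
        ((prodCModelIso k).symm (prodCModelIso k (v, z))).1,
       (a : ℂ) • ((prodCModelIso k).symm (prodCModelIso k (v, z))).2) = _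
  rw [ContinuousLinearEquiv.symm_apply_apply, smul_eq_mul]
  rfl

/-- The same, at a point written `mk n w`. [folklore] -/
theorem mfderiv_const_smul_mk_tangentLift
    (hθ : ContMDiff ((𝓡 1).prod (𝓡 k)) (𝓡 k) ∞ (fun x : Circle × N => x.1 • x.2))
    (a : Circle) (n : N) (w : ℂ) (v : EuclideanSpace ℝ (Fin k)) (z : ℂ) :
    mfderiv (𝓡 (k + 2)) (𝓡 (k + 2)) (fun q : ProdC k N => a • q) (mk n w) (tangentLift k v z) =
      tangentLift k (mfderiv (𝓡 k) (𝓡 k) (fun x : N => a • x) n v) ((a : ℂ) * z) :=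
  mfderiv_const_smul_prodC_tangentLift hθ a (mk n w) v z

/-! ### The fundamental vector field of the diagonal action -/

/-- `d/dt (e^{it} · w) = i · e^{it} · w` (as a real derivative of a curve in `ℂ`). [folklore] -/
theorem hasDerivAt_coe_circleExp_mul (w : ℂ) (t : ℝ) :
    HasDerivAt (fun s : ℝ => ((Circle.exp s : Circle) : ℂ) * w)
      (Complex.I * Complex.exp (t * Complex.I) * w) t := by
  have h : (fun s : ℝ => ((Circle.exp s : Circle) : ℂ) * w) =
      fun s : ℝ => Complex.exp (s * Complex.I) * w :=
    funext fun s => by rw [Circle.coe_exp]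
  rw [h]
  have h1 : HasDerivAt (fun s : ℝ => (s : ℂ) * Complex.I) Complex.I t := by
    simpa using (Complex.ofRealCLM.hasDerivAt (x := t)).mul_const Complex.I
  have h2 : HasDerivAt (fun s : ℝ => Complex.exp (s * Complex.I))
      (Complex.exp (t * Complex.I) * Complex.I) t := (Complex.hasDerivAt_exp _).comp t h1
  have h3 := h2.mul_const w
  have h4 : Complex.exp (↑t * Complex.I) * Complex.I * w = Complex.I * Complex.exp (↑t * Complex.I) * w := by
    ring
  rw [h4] at h3
  exact h3

/-- The curve `t ↦ e^{it} w` in `ℂ`, as a map of manifolds, has differential `c ↦ c (i w)` at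
`t = 0`. [folklore] -/
theorem hasMFDerivAt_coe_circleExp_mul_zero (w : ℂ) :
    HasMFDerivAt 𝓘(ℝ, ℝ) 𝓘(ℝ, ℂ) (fun s : ℝ => ((Circle.exp s : Circle) : ℂ) * w) 0
      (ContinuousLinearMap.smulRight (1 : ℝ →L[ℝ] ℝ) (Complex.I * w)) := by
  refine hasMFDerivAt_iff_hasFDerivAt.2 ?_
  have h := (hasDerivAt_coe_circleExp_mul w 0).hasFDerivAt
  simp only [Complex.ofReal_zero, zero_mul, Complex.exp_zero, mul_one] at h
  exact h

/-- **The fundamental vector of the diagonal action**: at `mk n w` it is `L (X_n, i w)`, `X_n`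
the fundamental vector of the action on `N`. [cite: CannasdasilvaGuilleminPires2010, §2.3] -/
theorem mfderiv_circleOrbit_prodC
    (hθ : ContMDiff ((𝓡 1).prod (𝓡 k)) (𝓡 k) ∞ (fun x : Circle × N => x.1 • x.2))
    (n : N) (w : ℂ) :
    mfderiv 𝓘(ℝ, ℝ) (𝓡 (k + 2)) (fun t : ℝ => Circle.exp t • (mk n w : ProdC k N)) 0 (1 : ℝ) =
      tangentLift k (mfderiv 𝓘(ℝ, ℝ) (𝓡 k) (fun t : ℝ => Circle.exp t • n) 0 (1 : ℝ))
        (Complex.I * w) := by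
  have hcurve : (fun t : ℝ => Circle.exp t • (mk n w : ProdC k N)) =
      fun t : ℝ => (mk (Circle.exp t • n) (((Circle.exp t : Circle) : ℂ) * w) : ProdC k N) := by
    funext t
    rfl
  have hg : HasMFDerivAt 𝓘(ℝ, ℝ) (𝓡 k) (fun t : ℝ => Circle.exp t • n) 0
      (mfderiv 𝓘(ℝ, ℝ) (𝓡 k) (fun t : ℝ => Circle.exp t • n) 0) :=
    ((contMDiff_circleOrbit (θ := fun (a : Circle) (x : N) => a • x) hθ n).mdifferentiableAt
      (by simp)).hasMFDerivAt
  have H := hasMFDerivAt_prodC_mk (N := N) hg (hasMFDerivAt_coe_circleExp_mul_zero w)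
  rw [hcurve, H.mfderiv, tangentLift_eq]
  show prodCModelIso k (mfderiv 𝓘(ℝ, ℝ) (𝓡 k) (fun t : ℝ => Circle.exp t • n) 0 (1 : ℝ),
    (1 : ℝ) • (Complex.I * w)) = _
  rw [one_smul]

end ProdC

end Literature.Geometry.Manifold

end
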